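import Mathlib
import HarnessLib
import Summits.AtomisticToContinuum.FouriersLaw.Theses.PhononMeanFreePath
import Literature.MathematicalPhysics.KineticTheory.PhaseSpacePoisson

/-!
# Sketch — crux-ideate stmt-AtomisticToContinuum-11811 (IncoherentChannel), round 1, ideator 1

First lemmas of two levers, typed over existing declarations (no skeleton, no stubs):

* Lever A (`replica-ladder-thermal-drag`): the cumulant channel `C_N − 2 r_N²` equals twice the
  sum-mode → difference-mode contact-to-contact kinetic-energy covariance of a REPLICA PAIR
  (two independent copies, 45° rotation), and the infinitesimal replica rotation gives an exact
  Ward identity with ONE explicit anharmonic (charge-4, "umklapp") vertex `Φ = {M, H ⊕ H}`.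
* Lever B (`forgetting-before-hearing`): law of total variance w.r.t. the initial microstate
  splits `C_N − 2r_N²` into a HEATING part `Cov(p₀², Var(p_N(t) | X₀))` and a PUSH part
  `Cov(p₀², (K_t p_N)²) − 2 r_N²`; the conditional variance is generated ONLY at the two contact
  momenta (Leibniz defect / carré du champ of the Langevin generator).
-/

noncomputable section

open MeasureTheory Filter Topology Finset
open scoped BigOperators NNReal

namespace Summit.AtomisticToContinuum.FouriersLaw.Cruxes.IncoherentChannel.Ideator1

open Literature.MathematicalPhysics.KineticTheory.HeatConduction
open Literature.MathematicalPhysics.KineticTheory.HeatConduction.OscillatorChain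

/-! ### The crux's objects (chain of `N+1` sites, both baths at `T`) -/

variable (ω₂ lam β γ : ℝ) (N : ℕ) (T : ℝ)

/-- The chain. -/
abbrev P : OscillatorChain := pinnedChain ω₂ lam β γ

/-- Equilibrium (Gibbs) measure `μ₀` of the `(N+1)`-site chain. -/
abbrev μ : Measure (PhaseSpace (N + 1)) := (pinnedChain ω₂ lam β γ).gibbsMeasure (N + 1) T

/-- Equal-temperature transition kernel `K_t(z, ·)`. -/
abbrev K (t : ℝ) (z : PhaseSpace (N + 1)) : Measure (PhaseSpace (N + 1)) :=
  (pinnedChain ω₂ lam β γ).transitionKernel (N + 1) T T t.toNNReal z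

/-- Forecast of the far momentum: `m_t(z) = (K_t p_N)(z)`. -/
def forecast (t : ℝ) (z : PhaseSpace (N + 1)) : ℝ := ∫ y, y.2 (Fin.last N) ∂(K ω₂ lam β γ N T t z)

/-- Forecast of the far kinetic energy: `(K_t p_N²)(z)`. -/
def forecastSq (t : ℝ) (z : PhaseSpace (N + 1)) : ℝ := ∫ y, (y.2 (Fin.last N)) ^ 2 ∂(K ω₂ lam β γ N T t z)

/-- `r_N(t) = ∫ p₀ · K_t p_N dμ₀` (verbatim the crux's two-point function). -/
def rN (t : ℝ) : ℝ := ∫ z, z.2 0 * forecast ω₂ lam β γ N T t z ∂(μ ω₂ lam β γ N T)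

/-- `C_N(t) = Cov_μ₀(p₀², K_t p_N²)` (verbatim the crux's four-point function). -/
def CN (t : ℝ) : ℝ :=
  (∫ z, (z.2 0) ^ 2 * forecastSq ω₂ lam β γ N T t z ∂(μ ω₂ lam β γ N T)) -
    (∫ z, (z.2 0) ^ 2 ∂(μ ω₂ lam β γ N T)) * (∫ z, forecastSq ω₂ lam β γ N T t z ∂(μ ω₂ lam β γ N T))

/-- The crux's integrand: the cumulant ("incoherent") channel `C_N(t) − 2 r_N(t)²`. -/
def cumulantChannel (t : ℝ) : ℝ := CN ω₂ lam β γ N T t - 2 * rN ω₂ lam β γ N T t ^ 2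

/-- The crux restated through `cumulantChannel` (definitionally the route decl, see `crux_iff`). -/
def CruxViaChannel : Prop :=
  ∀ ω₂ lam β γ : ℝ, 0 < ω₂ → 0 < lam → 0 < β → 0 < γ → ∀ T : ℝ, 0 < T → ∃ κ : ℝ, 0 < κ ∧
    Tendsto (fun N : ℕ => (N : ℝ) * (γ ^ 2 / T ^ 2) * ∫ t in Set.Ioi (0 : ℝ), cumulantChannel ω₂ lam β γ N T t)
      atTop (nhds κ)

theorem crux_iff : CruxViaChannel ↔ Theses.PhononMeanFreePath.IncoherentChannel := Iff.rfl

/-! ### Lever A — the replica ladder (two independent copies, sum/difference modes) -/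

/-- Doubled phase space: a pair of replicas. -/
abbrev Pair (n : ℕ) : Type := PhaseSpace n × PhaseSpace n

/-- Sum-mode momentum `π_b = (p_b + p_b')/√2`. -/
def sumMom (b : Fin (N + 1)) (w : Pair (N + 1)) : ℝ := (w.1.2 b + w.2.2 b) / Real.sqrt 2

/-- Difference-mode momentum `ϖ_b = (p_b − p_b')/√2`. -/
def diffMom (b : Fin (N + 1)) (w : Pair (N + 1)) : ℝ := (w.1.2 b - w.2.2 b) / Real.sqrt 2

/-- Product equilibrium measure `ν = μ₀ ⊗ μ₀`. -/
abbrev ν : Measure (Pair (N + 1)) := (μ ω₂ lam β γ N T).prod (μ ω₂ lam β γ N T)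

/-- Product kernel `K_t ⊗ K_t` (independent replica dynamics). -/
abbrev K2 (t : ℝ) (w : Pair (N + 1)) : Measure (Pair (N + 1)) :=
  (K ω₂ lam β γ N T t w.1).prod (K ω₂ lam β γ N T t w.2)

/-- CROSS-LEG ("thermal drag") contact-to-contact covariance of the replica ladder:
`Cov_ν(π₀(0)², ϖ_N(t)²)` — sum mode at the near contact, difference mode at the far contact. -/
def ladderCross (t : ℝ) : ℝ :=
  (∫ w, (sumMom N 0 w) ^ 2 * (∫ v, (diffMom N (Fin.last N) v) ^ 2 ∂(K2 ω₂ lam β γ N T t w)) ∂(ν ω₂ lam β γ N T)) -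
    (∫ w, (sumMom N 0 w) ^ 2 ∂(ν ω₂ lam β γ N T)) *
      (∫ w, (∫ v, (diffMom N (Fin.last N) v) ^ 2 ∂(K2 ω₂ lam β γ N T t w)) ∂(ν ω₂ lam β γ N T))

/-- SAME-LEG covariance `Cov_ν(π₀(0)², π_N(t)²)`. -/
def ladderSame (t : ℝ) : ℝ :=
  (∫ w, (sumMom N 0 w) ^ 2 * (∫ v, (sumMom N (Fin.last N) v) ^ 2 ∂(K2 ω₂ lam β γ N T t w)) ∂(ν ω₂ lam β γ N T)) -
    (∫ w, (sumMom N 0 w) ^ 2 ∂(ν ω₂ lam β γ N T)) *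
      (∫ w, (∫ v, (sumMom N (Fin.last N) v) ^ 2 ∂(K2 ω₂ lam β γ N T t w)) ∂(ν ω₂ lam β γ N T))

/-- FIRST LEMMA (A1), the LADDER IDENTITY (fixed `N`, every `t`; provable now: Fubini on the product,
independence of the copies, `E p = 0`, `E K_t p_N = 0` under the Gibbs measure):
`C_N(t) − 2 r_N(t)² = 2·Cov_ν(π₀², ϖ_N(t)²)` and `C_N(t) + 2 r_N(t)² = 2·Cov_ν(π₀², π_N(t)²)`. -/
def LadderIdentity : Prop :=
  ∀ ω₂ lam β γ : ℝ, 0 < ω₂ → 0 < lam → 0 < β → 0 < γ → ∀ T : ℝ, 0 < T → ∀ (N : ℕ) (t : ℝ), 0 < t →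
    cumulantChannel ω₂ lam β γ N T t = 2 * ladderCross ω₂ lam β γ N T t ∧
      CN ω₂ lam β γ N T t + 2 * rN ω₂ lam β γ N T t ^ 2 = 2 * ladderSame ω₂ lam β γ N T t

/-- The crux in ladder form: Fourier scaling of the CROSS-LEG conductance of the replica ladder. -/
def LadderDragLaw : Prop :=
  ∀ ω₂ lam β γ : ℝ, 0 < ω₂ → 0 < lam → 0 < β → 0 < γ → ∀ T : ℝ, 0 < T → ∃ κ : ℝ, 0 < κ ∧
    Tendsto (fun N : ℕ => (N : ℝ) * (γ ^ 2 / T ^ 2) * ∫ t in Set.Ioi (0 : ℝ), 2 * ladderCross ω₂ lam β γ N T t)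
      atTop (nhds κ)

/-- Glue (provable now by `integral_congr` under `LadderIdentity`): the drag law IS the crux. -/
def LadderReduction : Prop := LadderIdentity → (LadderDragLaw ↔ Theses.PhononMeanFreePath.IncoherentChannel)

theorem ladderReduction_holds : LadderReduction := by
  intro hL
  unfold LadderDragLaw Theses.PhononMeanFreePath.IncoherentChannel
  refine forall₄_congr fun ω₂ lam β γ => ?_
  refine forall₄_congr fun hω hl hβ hγ => ?_
  refine forall₂_congr fun T hT => ?_
  refine exists_congr fun κ => and_congr Iff.rfl ?_
  have key : ∀ N : ℕ, (∫ t in Set.Ioi (0 : ℝ), 2 * ladderCross ω₂ lam β γ N T t) =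
      ∫ t in Set.Ioi (0 : ℝ), cumulantChannel ω₂ lam β γ N T t := by
    intro N
    refine setIntegral_congr_fun measurableSet_Ioi fun t ht => ?_
    exact ((hL ω₂ lam β γ hω hl hβ hγ T hT N t ht).1).symm
  simp_rw [key]
  rfl

/-! #### Lever A, infinitesimal form: the replica rotation charge and the umklapp vertex -/

/-- Doubled Poisson bracket `{f, g}₂` (bracket in each replica's variables). -/
def poisson₂ {n : ℕ} (f g : Pair n → ℝ) (w : Pair n) : ℝ :=
  poisson (fun x => f (x, w.2)) (fun x => g (x, w.2)) w.1 + poisson (fun x' => f (w.1, x')) (fun x' => g (w.1, x')) w.2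

/-- Noether charge of the replica rotation (angular momentum in each `(q_j, q_j')`/`(p_j, p_j')` plane):
`M = Σ_j (q_j p_j' − q_j' p_j)`. `{M, ·}₂` is the infinitesimal rotation; `{M, z_j}₂ = i z_j` for
`z_j = p_j + i p_j'`. -/
def rotCharge {n : ℕ} (w : Pair n) : ℝ := ∑ j : Fin n, (w.1.1 j * w.2.2 j - w.2.1 j * w.1.2 j)

/-- Doubled Hamiltonian `H ⊕ H`. -/
def H₂ {n : ℕ} (Q : OscillatorChain) (w : Pair n) : ℝ := Q.hamiltonian n w.1 + Q.hamiltonian n w.2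

/-- The UMKLAPP VERTEX `Φ = {M, H ⊕ H}₂` (what the rotation does not preserve). -/
def vertex {n : ℕ} (Q : OscillatorChain) (w : Pair n) : ℝ := poisson₂ rotCharge (H₂ Q) w

/-- Its explicit form for `pinnedChain`: `Φ = lam Σ_j q_j q_j' (q_j'² − q_j²) + β Σ_bonds r_b r_b' (r_b'² − r_b²)`
(`r_b = q_{b+1} − q_b`): charge ±4 only, and `Φ ≡ 0` iff `lam = β = 0`. -/
def vertexExplicit {n : ℕ} (lam' β' : ℝ) (w : Pair n) : ℝ :=
  (∑ j : Fin n, lam' * (w.1.1 j * w.2.1 j * (w.2.1 j ^ 2 - w.1.1 j ^ 2))) +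
    ∑ b : Fin n, ∑ c : Fin n, if c.val = b.val + 1 then
      β' * ((w.1.1 c - w.1.1 b) * (w.2.1 c - w.2.1 b) * ((w.2.1 c - w.2.1 b) ^ 2 - (w.1.1 c - w.1.1 b) ^ 2)) else 0

/-- FIRST LEMMA (A2a), provable now (coordinate calculus): the vertex formula. -/
def VertexFormula : Prop :=
  ∀ (ω₂ lam β γ : ℝ) (n : ℕ) (w : Pair n), vertex (pinnedChain ω₂ lam β γ) w = vertexExplicit lam β w

/-- Doubled generator `L₂ = L ⊗ 1 + 1 ⊗ L` at equal temperatures. -/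
def gen₂ {n : ℕ} (Q : OscillatorChain) (T' : ℝ) (g : Pair n → ℝ) (w : Pair n) : ℝ :=
  Q.generator n T' T' (fun x => g (x, w.2)) w.1 + Q.generator n T' T' (fun x' => g (w.1, x')) w.2

/-- FIRST LEMMA (A2b), provable now (Jacobi identity `poisson_jacobi` + isotropy of the pair of
Ornstein–Uhlenbeck contacts): the rotation commutes with the doubled generator UP TO THE VERTEX,
`L₂{M, g}₂ − {M, L₂ g}₂ = −{Φ, g}₂`, equivalently `[{M,·}₂, L₂] = {Φ, ·}₂`. -/
def RotationDefect : Prop :=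
  ∀ (Q : OscillatorChain) (T' : ℝ) (n : ℕ) (g : Pair n → ℝ), ContDiff ℝ 3 g → ContDiff ℝ 3 Q.U → ContDiff ℝ 3 Q.V →
    ∀ w, poisson₂ rotCharge (gen₂ Q T' g) w - gen₂ Q T' (poisson₂ rotCharge g) w = poisson₂ (vertex Q) g w

/-- FIRST LEMMA (A2c), provable now (Gibbs integration by parts along the divergence-free rotation
field; tree: `integral_liouville_mul_gibbsDensity`-type lemmas): the STATIC WARD IDENTITY
`∫ {M, F}₂ dν = (1/T) ∫ F · Φ dν` for smooth polynomially bounded `F`. Stated for polynomial-type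
test functions `F` built from coordinates (here: any `C¹` `F` with `F`, `{M,F}₂` ν-integrable). -/
def StaticWard : Prop :=
  ∀ ω₂ lam β γ : ℝ, 0 < ω₂ → 0 ≤ lam → 0 ≤ β → ∀ T : ℝ, 0 < T → ∀ (N : ℕ) (F : Pair (N + 1) → ℝ),
    ContDiff ℝ 1 F → Integrable F (ν ω₂ lam β γ N T) →
    Integrable (poisson₂ rotCharge F) (ν ω₂ lam β γ N T) →
    Integrable (fun w => F w * vertex (pinnedChain ω₂ lam β γ) w) (ν ω₂ lam β γ N T) →
      ∫ w, poisson₂ rotCharge F w ∂(ν ω₂ lam β γ N T) =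
        (1 / T) * ∫ w, F w * vertex (pinnedChain ω₂ lam β γ) w ∂(ν ω₂ lam β γ N T)

/-- Real and imaginary parts of `z₀² = (p₀ + i p₀')²`: `a = p₀² − p₀'²`, `b = 2 p₀ p₀'`. -/
def reZ0sq (w : Pair (N + 1)) : ℝ := (w.1.2 0) ^ 2 - (w.2.2 0) ^ 2
def imZ0sq (w : Pair (N + 1)) : ℝ := 2 * (w.1.2 0) * (w.2.2 0)

/-- Real and imaginary parts of `K_t^{⊗2} z_N²`: `G_R = K_t p_N²(x) − K_t p_N²(x')`, `G_I = 2 K_t p_N(x) K_t p_N(x')`. -/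
def GR (t : ℝ) (w : Pair (N + 1)) : ℝ := forecastSq ω₂ lam β γ N T t w.1 - forecastSq ω₂ lam β γ N T t w.2
def GI (t : ℝ) (w : Pair (N + 1)) : ℝ := 2 * forecast ω₂ lam β γ N T t w.1 * forecast ω₂ lam β γ N T t w.2

/-- The DYNAMIC WARD IDENTITY (umklapp formula; exact at fixed `N`, from A2b by Duhamel and A2c):
`8·(C_N − 2r_N²)(t) = (1/T)·∫ Φ·(a·G_I + b·G_R) dν − ∫₀ᵗ ∫ [a · K_s^{⊗2}{Φ, G_I^{(t−s)}}₂ + b · K_s^{⊗2}{Φ, G_R^{(t−s)}}₂] dν ds`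
— the cumulant channel written with ONE explicit anharmonic vertex and fully dressed propagation. -/
def DynamicWard : Prop :=
  ∀ ω₂ lam β γ : ℝ, 0 < ω₂ → 0 < lam → 0 < β → 0 < γ → ∀ T : ℝ, 0 < T → ∀ (N : ℕ) (t : ℝ), 0 < t →
    8 * cumulantChannel ω₂ lam β γ N T t =
      (1 / T) * (∫ w, vertex (pinnedChain ω₂ lam β γ) w *
          (reZ0sq N w * GI ω₂ lam β γ N T t w + imZ0sq N w * GR ω₂ lam β γ N T t w) ∂(ν ω₂ lam β γ N T)) -
      ∫ s in (0 : ℝ)..t, ∫ w,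
          (reZ0sq N w * (∫ v, poisson₂ (vertex (pinnedChain ω₂ lam β γ)) (GI ω₂ lam β γ N T (t - s)) v ∂(K2 ω₂ lam β γ N T s w)) +
            imZ0sq N w * (∫ v, poisson₂ (vertex (pinnedChain ω₂ lam β γ)) (GR ω₂ lam β γ N T (t - s)) v ∂(K2 ω₂ lam β γ N T s w)))
        ∂(ν ω₂ lam β γ N T)

/-! ### Lever B — law of total variance at the far contact + Leibniz defect at the contacts -/

/-- Conditional variance of the far momentum given the initial microstate:
`v_t(z) = Var(p_N(t) | X₀ = z) = K_t p_N²(z) − (K_t p_N(z))²`. -/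
def condVar (t : ℝ) (z : PhaseSpace (N + 1)) : ℝ := forecastSq ω₂ lam β γ N T t z - forecast ω₂ lam β γ N T t z ^ 2

/-- HEATING part: `Cov_μ₀(p₀², v_t)`. -/
def heating (t : ℝ) : ℝ :=
  (∫ z, (z.2 0) ^ 2 * condVar ω₂ lam β γ N T t z ∂(μ ω₂ lam β γ N T)) -
    (∫ z, (z.2 0) ^ 2 ∂(μ ω₂ lam β γ N T)) * (∫ z, condVar ω₂ lam β γ N T t z ∂(μ ω₂ lam β γ N T))

/-- PUSH part: `Cov_μ₀(p₀², m_t²) − 2 r_N²` (vanishes identically when the forecast is linear in `p₀`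
with deterministic coefficient, i.e. in the harmonic chain). -/
def push (t : ℝ) : ℝ :=
  (∫ z, (z.2 0) ^ 2 * forecast ω₂ lam β γ N T t z ^ 2 ∂(μ ω₂ lam β γ N T)) -
    (∫ z, (z.2 0) ^ 2 ∂(μ ω₂ lam β γ N T)) * (∫ z, forecast ω₂ lam β γ N T t z ^ 2 ∂(μ ω₂ lam β γ N T)) -
    2 * rN ω₂ lam β γ N T t ^ 2

/-- FIRST LEMMA (B1), provable now (linearity of the Bochner integral, given the integrability that
the route's BoundaryKubo/CoherentDephasing supply): the TOTAL-VARIANCE SPLIT of the cumulant channel. -/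
def TotalVarianceSplit : Prop :=
  ∀ ω₂ lam β γ : ℝ, 0 < ω₂ → 0 < lam → 0 < β → 0 < γ → ∀ T : ℝ, 0 < T → ∀ (N : ℕ) (t : ℝ), 0 < t →
    cumulantChannel ω₂ lam β γ N T t = heating ω₂ lam β γ N T t + push ω₂ lam β γ N T t

/-- FIRST LEMMA (B2), the LEIBNIZ DEFECT IS GENERATED AT THE CONTACTS ONLY (carré du champ of the
Langevin generator: the Liouville part is a derivation, so `Γ(u,u) = γ T Σ_{b ∈ {0,N}} (∂_{p_b} u)²`):
`v_t(z) = 2 γ T Σ_{b ∈ {0, N}} ∫₀ᵗ K_s[(∂_{p_b} K_{t−s} p_N)²](z) ds`. Fixed-`N`, theorem-grade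
(Dynkin for polynomial observables + hypoelliptic smoothness of `K_u p_N`). -/
def ContactLeibnizDefect : Prop :=
  ∀ ω₂ lam β γ : ℝ, 0 < ω₂ → 0 < lam → 0 < β → 0 < γ → ∀ T : ℝ, 0 < T → ∀ (N : ℕ) (t : ℝ), 0 < t →
    ∀ z : PhaseSpace (N + 1), condVar ω₂ lam β γ N T t z =
      2 * γ * T * ∑ b ∈ ({0, Fin.last N} : Finset (Fin (N + 1))),
        ∫ s in (0 : ℝ)..t, ∫ y, (partialP b (forecast ω₂ lam β γ N T (t - s)) y) ^ 2 ∂(K ω₂ lam β γ N T s z)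

/-- Transfer target B(i): the HEATING part carries the whole conductivity. -/
def HeatingLimit : Prop :=
  ∀ ω₂ lam β γ : ℝ, 0 < ω₂ → 0 < lam → 0 < β → 0 < γ → ∀ T : ℝ, 0 < T → ∃ κ : ℝ, 0 < κ ∧
    (∀ N : ℕ, IntegrableOn (heating ω₂ lam β γ N T) (Set.Ioi 0)) ∧
    Tendsto (fun N : ℕ => (N : ℝ) * (γ ^ 2 / T ^ 2) * ∫ t in Set.Ioi (0 : ℝ), heating ω₂ lam β γ N T t)
      atTop (nhds κ)

/-- Transfer target B(ii): the PUSH part is `o(1/N)` after time integration (conditional-mean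
transmission from `p₀(0)` to `p_N(t)` and its microstate-to-microstate fluctuation both vanish). -/
def PushNegligible : Prop :=
  ∀ ω₂ lam β γ : ℝ, 0 < ω₂ → 0 < lam → 0 < β → 0 < γ → ∀ T : ℝ, 0 < T →
    (∀ N : ℕ, IntegrableOn (push ω₂ lam β γ N T) (Set.Ioi 0)) ∧
    Tendsto (fun N : ℕ => (N : ℝ) * ∫ t in Set.Ioi (0 : ℝ), push ω₂ lam β γ N T t) atTop (nhds 0)

/-- Input (F′) CONTACT FORECAST DECAY: the far contact momentum is unforecastable from the ENTIRE
initial microstate after an `N`-independent time, at an exponential (any `o(t⁻²)`-integrable rate would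
do) rate, in `L²` and `L⁴`: `‖K_t p_N‖₂² + ‖K_t p_N‖₄² ≤ C e^{-t/t_f}` for all `N`. Two-replica reading:
`‖K_t p_N‖₂² = E[p_N^{(1)}(t) p_N^{(2)}(t)]` for copies with common initial data and independent noises.
FALSE at `lam = β = 0` (forecast skill decays only on `t ~ N/γ`). -/
def ContactForecastDecay : Prop :=
  ∀ ω₂ lam β γ : ℝ, 0 < ω₂ → 0 < lam → 0 < β → 0 < γ → ∀ T : ℝ, 0 < T → ∃ C tf : ℝ, 0 < tf ∧
    ∀ (N : ℕ) (t : ℝ), 0 ≤ t →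
      (∫ z, forecast ω₂ lam β γ N T t z ^ 2 ∂(μ ω₂ lam β γ N T)) +
        Real.sqrt (∫ z, forecast ω₂ lam β γ N T t z ^ 4 ∂(μ ω₂ lam β γ N T)) ≤ C * Real.exp (-t / tf)

/-- Input (L) CONTACT CAUSALITY (almost-linear light cone, Buttà–Marchioro type, for the open chain):
inside the cone `t ≤ c·N` the far forecast does not yet depend on `p₀`, so the two `p₀`-sensitive
quantities of the split are exponentially small there. -/
def ContactCausality : Prop :=
  ∀ ω₂ lam β γ : ℝ, 0 < ω₂ → 0 < lam → 0 < β → 0 < γ → ∀ T : ℝ, 0 < T → ∃ c C a : ℝ, 0 < c ∧ 0 < a ∧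
    ∀ (N : ℕ) (t : ℝ), 0 < t → t ≤ c * N →
      |rN ω₂ lam β γ N T t| ≤ C * Real.exp (-a * ((N : ℝ) - t / c)) ∧
        |push ω₂ lam β γ N T t| ≤ C * Real.exp (-a * ((N : ℝ) - t / c))

/-- "Forgetting before hearing": (F′) ∧ (L) kill the push term … -/
def PushFromForecast : Prop := ContactForecastDecay → ContactCausality → PushNegligible

/-- … and, as a bonus for the route, the SAME two inputs close the coherent channel (crux A):
`|r_N(t)| ≤ √T ‖K_t p_N‖₂` outside the cone, `≈ 0` inside. (Real analysis + Cauchy–Schwarz; not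
proved here — a crux-plan stub.) -/
def CoherentFromForecast : Prop :=
  ContactForecastDecay → ContactCausality → Theses.PhononMeanFreePath.CoherentDephasing

/-- Glue of lever B (provable now: `integral_add` + `Tendsto.add`, exactly as the route's `closes`). -/
def HeatingReduction : Prop :=
  TotalVarianceSplit → HeatingLimit → PushNegligible → Theses.PhononMeanFreePath.IncoherentChannel

theorem heatingReduction_holds : HeatingReduction := by
  intro hS hH hP ω₂ lam β γ hω hl hβ hγ T hT
  obtain ⟨κ, hκ, hint, hlim⟩ := hH ω₂ lam β γ hω hl hβ hγ T hT
  obtain ⟨hintP, hlimP⟩ := hP ω₂ lam β γ hω hl hβ hγ T hT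
  refine ⟨κ, hκ, ?_⟩
  have key : ∀ N : ℕ, (N : ℝ) * (γ ^ 2 / T ^ 2) * (∫ t in Set.Ioi (0 : ℝ), cumulantChannel ω₂ lam β γ N T t) =
      (N : ℝ) * (γ ^ 2 / T ^ 2) * (∫ t in Set.Ioi (0 : ℝ), heating ω₂ lam β γ N T t) +
        (γ ^ 2 / T ^ 2) * ((N : ℝ) * ∫ t in Set.Ioi (0 : ℝ), push ω₂ lam β γ N T t) := by
    intro N
    have h1 : (∫ t in Set.Ioi (0 : ℝ), cumulantChannel ω₂ lam β γ N T t) =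
        ∫ t in Set.Ioi (0 : ℝ), (heating ω₂ lam β γ N T t + push ω₂ lam β γ N T t) := by
      refine setIntegral_congr_fun measurableSet_Ioi fun t ht => ?_
      exact hS ω₂ lam β γ hω hl hβ hγ T hT N t ht
    rw [h1, integral_add (hint N) (hintP N)]
    ring
  show Tendsto (fun N : ℕ => (N : ℝ) * (γ ^ 2 / T ^ 2) * ∫ t in Set.Ioi (0 : ℝ), cumulantChannel ω₂ lam β γ N T t)
    atTop (nhds κ)
  simp_rw [key]
  simpa using hlim.add (hlimP.const_mul (γ ^ 2 / T ^ 2))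

end Summit.AtomisticToContinuum.FouriersLaw.Cruxes.IncoherentChannel.Ideator1
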